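/-
Copyright (c) 2026 the pub-hodgecm-mathlib formalisation cell (harness21).  Prover seat hodgecm-mathlib-K2E1-p12 (g6), Track B ∕ K2-LIT, h413 = `stmt-HodgeConjecture-24833`,
R90-TF section S8 «ContSpec-n½», ESTATE T, S8 dealer R90-CS-plan (g3) deal S8-R229 (1) ∕ ruling J-S8-CO step (2): the GENERIC RIESZ BRIDGE between the multiplicity-space LINE of
★ `R90S8KTypeSliceLineU3` §3 (`Hom_{M}(χ, π|_M)` is a line, Gelfand's trick) and the CO-WEIGHT FUNCTIONAL LINE of ★ FILE B's letter `hCO` (the functionals `l` with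
`l (π(m) x) = χ(m) · l x` form a line), on a finite-dimensional Hilbert space; plus the two transports the assembly (5) needs (restriction along `ι : M →* K`, pull-back along a linear
trivialisation `e : V ≃ₗ E`).
-/
import Literature.RepresentationTheory.CompactGroups.KTypeMultiplicityOneOfCommutingOrbital   -- ★ `ContRepresentation.HomSpace` API (`HilbertRepMultiplicitySpace`), `inner_rep_apply_left`, `IsUnitary`
import Mathlib.Analysis.InnerProductSpace.Dual
import HarnessLib

/-!
# R90-TF · S8 «ContSpec-n½» — `R90S8CoweightLineOfHomSpaceLineU3`: THE CO-WEIGHT FUNCTIONAL LINE FROM THE MULTIPLICITY-SPACE LINE (Riesz bridge, J-S8-CO step (2))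

Cell `hodgecm-mathlib`, crux H413 (`stmt-HodgeConjecture-24833`, lane `--supports … --as helper`), route of record `HCCMUnconditional`; R90-TF section S8, ESTATE T, sub-socket (R)′
row `hEXP` (★ `R90S8ResGMidRowsOfTauExportsClosedU3.hEXP_tauRow_closed`, whose one representation-theoretic letter is `hCO`, the CO-WEIGHT LINE at the archimedean group of record).
THEOREMS ONLY (no `def`, no `instance`, no `notation`, no named-fact hypothesis, no `sorry`; default heartbeats); GENERIC (abstract group `K`, abstract Hilbert space `X`); count-neutral;
CLOSES NO SOCKET.

THE MATHEMATICS.  Let `ρ` be a UNITARY representation of a group `K` on a finite-dimensional complex Hilbert space `X`, and `τ` a unitary representation of `K` on `ℂ` (a unitary character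
`χ(k) := τ k 1`, `|χ(k)| = 1`).  ★ `R90S8KTypeSliceLineU3` §3 (and its product version, J-S8-CO step (3)) delivers «the multiplicity space `Hom_K(τ, ρ)` (★ `ContRepresentation.HomSpace τ ρ`)
is at most a LINE».  The letter `hCO` wants «the linear functionals `l : X → ℂ` with `l (ρ k x) = χ(k) · l x` form at most a LINE».  The bridge is Riesz: `l = ⟪v, ·⟫` for a unique
`v ∈ X` (`InnerProductSpace.toDual`); unitarity `ρ(k)† = ρ(k⁻¹)` (★ `inner_rep_apply_left`) and `χ(k⁻¹) = conj χ(k)` (`|χ| = 1`) make `v` a `χ`-WEIGHT VECTOR, `ρ k v = χ(k) • v`; so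
`c ↦ c • v` (`ContinuousLinearMap.toSpanSingleton ℂ v`) is an element of `Hom_K(τ, ρ)`, hence `= c_l • S₀`, i.e. `v = c_l • S₀ 1` and `l = conj c_l • ⟪S₀ 1, ·⟫`.
[Knapp1986 VIII §3 (Frobenius reciprocity, weight vectors vs. functionals); DeitmarEchterhoff2014 Lemma 6.1.7, §7.3 Lemma 7.3.1 (unitary duals, the multiplicity space)]
* §1 scalar calculus of a representation on `ℂ`: `lineRep_apply_eq_mul` (`τ k c = c · τ k 1`), `norm_lineRep_one_eq_one` (`|τ k 1| = 1` for unitary `τ`), `lineRep_inv_one_eq_conj`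
  (`τ k⁻¹ 1 = conj (τ k 1)`).
* §2 **`coweightLine_of_homSpaceLine (ρ) (hρ : ρ.IsUnitary) (τ) (hτu) (hline)`** — THE BRIDGE: `∃ l₀, ∀ l, (∀ k x, l (ρ k x) = τ k 1 * l x) → ∃ a, l = a • l₀`.
* §3 transports for the assembly: **`coweightLine_of_homSpaceLine_restrict (ι : M →* K) (π) …`** (the same along `π.restrict ι`, the shape ★ (α) §3 outputs) and
  **`coweightLine_of_linearEquiv (e : V ≃ₗ[ℂ] X) …`** (pull-back of the functional line along a linear trivialisation intertwining `ρ_V` and `ρ_X` — J-S8-CO step (4) delivers such an `e`).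
HONEST LABEL: HC_CM is proved only modulo the 7 printed citations (2 remaining named inputs: hLiu418 = `stmt-HodgeConjecture-24832`, h413 = `stmt-HodgeConjecture-24833`) until rung 0
closes; generic leaf, pays no letter by itself (`hCO` needs steps (3) product realisation, (4) Hilbert packaging, (5) assembly); REL ≠ ★ ≠ BUILT; count-neutral; unconditional.

## References
* [Knapp1986] A. W. Knapp, *Representation Theory of Semisimple Groups* (1986), VIII §3.
* [DeitmarEchterhoff2014] A. Deitmar, S. Echterhoff, *Principles of Harmonic Analysis* (2nd ed., 2014), Lemma 6.1.7; §7.3 Lemma 7.3.1.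
* [Helgason2000] S. Helgason, *Groups and Geometric Analysis* (AMS 2000), Ch. IV §3 Thm. 3.1.
-/

set_option autoImplicit false
set_option linter.dupNamespace false  -- the mandated namespace `…HodgeConjecture.HodgeConjecture.R90.S8` (LEAD #1 L1) repeats the summit's segment

noncomputable section

open ContRepresentation Literature.RepresentationTheory.CompactGroups Literature.NumberTheory.Automorphic
open scoped InnerProductSpace ComplexConjugate

namespace Summit.HodgeConjecture.HodgeConjecture.R90.S8

/-! ## §1 Scalar calculus of a representation on the line `ℂ` -/

section LineRep

variable {K : Type*} [Group K]

/-- A representation of `K` on `ℂ` acts by the scalar `τ k 1`: `τ k c = c · τ k 1` (`ℂ`-linearity). [cite: Knapp1986, VIII §3] -/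
theorem lineRep_apply_eq_mul (τ : ContRepresentation ℂ K ℂ) (k : K) (c : ℂ) : τ k c = c * τ k 1 := by
  have h : τ k (c • (1 : ℂ)) = c • τ k 1 := map_smul (τ k) c 1
  rwa [smul_eq_mul, mul_one, smul_eq_mul] at h

/-- For a UNITARY representation of `K` on `ℂ` (`⟪τ k v, τ k w⟫ = ⟪v, w⟫`) the scalar `τ k 1` has modulus `1`. [cite: DeitmarEchterhoff2014, Lemma 6.1.7] -/
theorem norm_lineRep_one_eq_one (τ : ContRepresentation ℂ K ℂ) (hτu : ∀ (k : K) (v w : ℂ), ⟪τ k v, τ k w⟫_ℂ = ⟪v, w⟫_ℂ) (k : K) :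
    ‖τ k 1‖ = 1 := by
  have h := hτu k 1 1
  rw [inner_self_eq_norm_sq_to_K, inner_self_eq_norm_sq_to_K, norm_one] at h
  have h' : ‖τ k 1‖ ^ 2 = 1 ^ 2 := by exact_mod_cast h
  exact (sq_eq_sq₀ (norm_nonneg _) zero_le_one).1 h'

/-- For a unitary representation of `K` on `ℂ`: `τ k⁻¹ 1 = conj (τ k 1)` (the inverse of a complex number of modulus `1` is its conjugate). [cite: DeitmarEchterhoff2014, Lemma 6.1.7] -/
theorem lineRep_inv_one_eq_conj (τ : ContRepresentation ℂ K ℂ) (hτu : ∀ (k : K) (v w : ℂ), ⟪τ k v, τ k w⟫_ℂ = ⟪v, w⟫_ℂ) (k : K) :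
    τ k⁻¹ 1 = conj (τ k 1) := by
  -- `τ k⁻¹ (τ k 1) = τ (k⁻¹ k) 1 = 1`, and `τ k⁻¹ (τ k 1) = τ k 1 · τ k⁻¹ 1`
  have h2 : τ k⁻¹ (τ k 1) = 1 := by
    show (τ k⁻¹ * τ k) 1 = 1
    rw [← map_mul, inv_mul_cancel, (map_one τ : τ 1 = 1)]
    rfl
  rw [lineRep_apply_eq_mul τ k⁻¹ (τ k 1)] at h2
  calc τ k⁻¹ 1 = (τ k 1)⁻¹ := (eq_inv_of_mul_eq_one_right h2)
    _ = conj (τ k 1) := Complex.inv_eq_conj (norm_lineRep_one_eq_one τ hτu k)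

end LineRep

/-! ## §2 The bridge: the multiplicity-space line `Hom_K(τ, ρ)` gives the co-weight functional line -/

section Bridge

variable {K : Type*} [Group K]
variable {X : Type*} [NormedAddCommGroup X] [InnerProductSpace ℂ X] [CompleteSpace X]

/-- **THE CO-WEIGHT FUNCTIONAL LINE FROM THE MULTIPLICITY-SPACE LINE** (J-S8-CO step (2)).  Let `ρ` be a unitary representation of `K` on a finite-dimensional Hilbert space `X`, `τ` a unitary
representation of `K` on `ℂ` (the character `k ↦ τ k 1`), and suppose the multiplicity space `Hom_K(τ, ρ)` is at most a line (`hline`, the output of ★ `R90S8KTypeSliceLineU3`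
`exists_forall_homSpace_torus_eq_smul_of_transpose_realisation`).  Then the linear functionals `l` on `X` with `l (ρ k x) = τ k 1 · l x` form at most a line: `∃ l₀, ∀ l, (law) → ∃ a, l = a • l₀`.
Proof: Riesz `l = ⟪v, ·⟫`; `ρ(k)† = ρ(k⁻¹)` and `τ k⁻¹ 1 = conj (τ k 1)` make `v` a weight vector `ρ k v = τ k 1 • v`; `c ↦ c • v` lies in `Hom_K(τ, ρ)`, so `v = c • S₀ 1` and
`l = conj c • ⟪S₀ 1, ·⟫`. [cite: Knapp1986, VIII §3] [cite: DeitmarEchterhoff2014, Lemma 7.3.1] -/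
theorem coweightLine_of_homSpaceLine [FiniteDimensional ℂ X] (ρ : ContRepresentation ℂ K X) (hρ : ρ.IsUnitary) (τ : ContRepresentation ℂ K ℂ)
    (hτu : ∀ (k : K) (v w : ℂ), ⟪τ k v, τ k w⟫_ℂ = ⟪v, w⟫_ℂ)
    (hline : ∃ S₀ : HomSpace τ ρ, ∀ S : HomSpace τ ρ, ∃ c : ℂ, S = c • S₀) :
    ∃ l₀ : X →ₗ[ℂ] ℂ, ∀ l : X →ₗ[ℂ] ℂ, (∀ (k : K) (x : X), l (ρ k x) = τ k 1 * l x) → ∃ a : ℂ, l = a • l₀ := by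
  obtain ⟨S₀, hS₀⟩ := hline
  refine ⟨innerₛₗ ℂ (S₀.toCLM 1), fun l hl => ?_⟩
  -- the Riesz vector of `l`
  obtain ⟨v, hvx⟩ : ∃ v : X, ∀ x : X, ⟪v, x⟫_ℂ = l x :=
    ⟨(InnerProductSpace.toDual ℂ X).symm (LinearMap.toContinuousLinearMap l), fun x => by
      rw [InnerProductSpace.toDual_symm_apply]; rfl⟩
  -- `v` is a weight vector for the character `k ↦ τ k 1`
  have hweight : ∀ k : K, ρ k v = τ k 1 • v := fun k => by
    refine ext_inner_right ℂ fun x => ?_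
    rw [inner_rep_apply_left hρ k v x, hvx, hl, inner_smul_left, hvx, lineRep_inv_one_eq_conj τ hτu k]
  -- the intertwiner `c ↦ c • v : ℂ → X`
  have hT : ContinuousLinearMap.toSpanSingleton ℂ v ∈ Schur.intertwiners τ ρ := by
    rw [Schur.mem_intertwiners]
    intro k
    refine ContinuousLinearMap.ext_ring ?_
    simp only [ContinuousLinearMap.comp_apply, ContinuousLinearMap.toSpanSingleton_apply, one_smul, hweight]
  obtain ⟨c, hc⟩ := hS₀ (HomSpace.mk _ hT)
  -- `v = c • S₀ 1`
  have hvc : v = c • S₀.toCLM 1 := by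
    have h := congrArg (fun S : HomSpace τ ρ => S.toCLM 1) hc
    simp only [HomSpace.toCLM_mk, HomSpace.toCLM_smul, ContinuousLinearMap.toSpanSingleton_apply, one_smul] at h
    exact h
  refine ⟨conj c, LinearMap.ext fun x => ?_⟩
  rw [LinearMap.smul_apply, innerₛₗ_apply_apply, ← hvx, hvc, inner_smul_left, smul_eq_mul]

end Bridge

/-! ## §3 Transports for the assembly: restriction along `ι : M →* K`, pull-back along a linear trivialisation -/

section Transport

variable {K : Type*} [Group K] {M : Type*} [Group M]
variable {X : Type*} [NormedAddCommGroup X] [InnerProductSpace ℂ X] [CompleteSpace X]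

/-- **The bridge along a restriction** (the shape ★ `R90S8KTypeSliceLineU3` §3 outputs): for `π` a unitary representation of `K` on a finite-dimensional Hilbert space `X`, `ι : M →* K`, and `τ`
a unitary representation of `M` on `ℂ` with `Hom_M(τ, π|_M)` at most a line, the functionals `l` with `l (π (ι m) x) = τ m 1 · l x` form at most a line. [cite: Knapp1986, VIII §3]
[cite: DeitmarEchterhoff2014, Lemma 7.3.1] -/
theorem coweightLine_of_homSpaceLine_restrict [FiniteDimensional ℂ X] (ι : M →* K) (π : ContRepresentation ℂ K X) (hU : π.IsUnitary) (τ : ContRepresentation ℂ M ℂ)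
    (hτu : ∀ (m : M) (v w : ℂ), ⟪τ m v, τ m w⟫_ℂ = ⟪v, w⟫_ℂ)
    (hline : ∃ S₀ : HomSpace τ (π.restrict ι), ∀ S : HomSpace τ (π.restrict ι), ∃ c : ℂ, S = c • S₀) :
    ∃ l₀ : X →ₗ[ℂ] ℂ, ∀ l : X →ₗ[ℂ] ℂ, (∀ (m : M) (x : X), l (π (ι m) x) = τ m 1 * l x) → ∃ a : ℂ, l = a • l₀ :=
  coweightLine_of_homSpaceLine (π.restrict ι) (fun m => hU (ι m)) τ hτu hline

omit [Group M] in
/-- **Pull-back of the co-weight functional line along a linear trivialisation.**  If `e : V ≃ₗ[ℂ] E` intertwines the operators `ρ m` on `V` with the operators `π m` on `E`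
(`π m (e v) = e (ρ m v)`), and on `E` the functionals with `l (π m x) = χ m · l x` form at most a line, then so do the functionals on `V` with `l (ρ m v) = χ m · l v` (pure linear algebra:
`l ↦ l ∘ e.symm`, `l₀ ↦ l₀ ∘ e`). [cite: Knapp1986, VIII §3] -/
theorem coweightLine_of_linearEquiv {V : Type*} [AddCommGroup V] [Module ℂ V] {E : Type*} [AddCommGroup E] [Module ℂ E] (e : V ≃ₗ[ℂ] E)
    (ρ : M → V →ₗ[ℂ] V) (π : M → E → E) (hπ : ∀ (m : M) (v : V), π m (e v) = e (ρ m v)) (χ : M → ℂ)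
    (hE : ∃ l₀ : E →ₗ[ℂ] ℂ, ∀ l : E →ₗ[ℂ] ℂ, (∀ (m : M) (x : E), l (π m x) = χ m * l x) → ∃ a : ℂ, l = a • l₀) :
    ∃ l₀ : V →ₗ[ℂ] ℂ, ∀ l : V →ₗ[ℂ] ℂ, (∀ (m : M) (v : V), l (ρ m v) = χ m * l v) → ∃ a : ℂ, l = a • l₀ := by
  obtain ⟨l₀, hl₀⟩ := hE
  refine ⟨l₀ ∘ₗ e.toLinearMap, fun l hl => ?_⟩
  obtain ⟨a, ha⟩ := hl₀ (l ∘ₗ e.symm.toLinearMap) fun m x => by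
    have hx : π m x = e (ρ m (e.symm x)) := by rw [← hπ, LinearEquiv.apply_symm_apply]
    simp only [LinearMap.comp_apply, LinearEquiv.coe_coe]
    rw [hx, LinearEquiv.symm_apply_apply, hl]
  refine ⟨a, LinearMap.ext fun v => ?_⟩
  have h := LinearMap.congr_fun ha (e v)
  simp only [LinearMap.comp_apply, LinearEquiv.coe_coe, LinearEquiv.symm_apply_apply, LinearMap.smul_apply] at h
  simp only [LinearMap.smul_apply, LinearMap.comp_apply, LinearEquiv.coe_coe]
  exact h

end Transport

end Summit.HodgeConjecture.HodgeConjecture.R90.S8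

end
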